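import Summits.Ventures.PercRepro.S1CFSimpleCaps
import Summits.Ventures.PercRepro.S1CFGDouble

/-!
# PercRepro — THE `4`- AND `5`-SET CAPS OF A SIMPLE COLOOP-FREE MATROID OF NULLITY `ν` (p1, gen 38; p7's case (IV))

p7 g18's NEXT FRONTIER prices the case (IV) of ν = 4 of the cell `(13, 9)` — `N = M ／ W` SIMPLE (no dependent pair),
coloop-free, of nullity `5` on `13` points — at `3.09` with trivial `5`-set counts; the LP closes at `≈ 0.85` once the
rank-`≤ 3` `5`-sets are bounded by a few hundred. The double count of S1CFGDouble gives every count for free.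
For `N` loopless, coloop-free, nullity `ν` (`hd`), with NO dependent pair (`h0`), `n = |E|`, `rk E = n − ν`:
* **`ncard_three_eRk_le_two_le`** — `Q₃² = D₃ ≤ C(ν + 2, 3)` (every dependent `3`-set is a triangle; the circuit count);
* **`four_mul_ncard_four_eRk_le_two_le`** — `4 · Q₄² ≤ (ν − 2) · C(ν + 2, 3)` (`2 < rk E`; a rank-`2` `4`-set has four
  triangles, a triangle `T` extends only inside `cl T`, of `≤ ν + 1` points);
* **`ncard_four_eRk_le_three_le`** — `Q₄³ = D₄ ≤ (n − 3) · C(ν + 2, 3) + C(ν + 3, 4)` (the split with `D₂ = 0`);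
* **`five_mul_ncard_five_eRk_le_two_le`** — `5 · Q₅² ≤ (ν − 3) · Q₄²` (`2 < rk E`);
* **`five_mul_ncard_five_eRk_le_three_le`** — `5 · Q₅³ ≤ (ν − 2) · Q₄³ + (n − 4) · Q₄²` (`3 < rk E`).
At `ν = 5`: `D₃ ≤ 35`, `Q₄² ≤ 26`, `D₄ ≤ 35(n − 3) + 70` (`420` at `n = 13`), `Q₅² ≤ 10`, `Q₅³ ≤ 298` at `n = 13`
(`325` at `n = 14`) — S1CFGSimpleFiveValues. Nothing about any cell is claimed. Axioms: standard.
-/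

open scoped Matroid

namespace PercRepro

namespace S1CFG

open Set S1CF

variable {α : Type}

/-- **`D₃ ≤ C(ν + 2, 3)` without dependent pairs** (rank form): every `3`-set of rank `≤ 2` is a triangle. -/
theorem ncard_three_eRk_le_two_le_of_no_dep_pair (M : Matroid α) [M.Finite] {ν : ℕ}
    (hd : M.E.encard = M.eRank + (ν : ℕ∞))
    (h0 : {P : Set α | P ⊆ M.E ∧ P.ncard = 2 ∧ M.Dep P}.ncard = 0) :
    {X : Set α | X ⊆ M.E ∧ X.ncard = 3 ∧ M.eRk X ≤ 2}.ncard ≤ (ν + 2).choose 3 := by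
  have hEfin := M.ground_finite
  have hno : ∀ P, P ⊆ M.E → P.ncard = 2 → ¬ M.Dep P := by
    intro P hPE hP2 hPdep
    have hmem : P ∈ {P : Set α | P ⊆ M.E ∧ P.ncard = 2 ∧ M.Dep P} := ⟨hPE, hP2, hPdep⟩
    rw [Set.ncard_eq_zero (hEfin.finite_subsets.subset (fun P hP => hP.1))] at h0
    rw [h0] at hmem
    exact hmem
  have hsub : {X : Set α | X ⊆ M.E ∧ X.ncard = 3 ∧ M.eRk X ≤ 2} ⊆
      {C : Set α | C ⊆ M.E ∧ M.IsCircuit C ∧ C.ncard = 3} := by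
    intro X hX
    obtain ⟨hXE, hX3, hXr⟩ := hX
    have hXfin : X.Finite := hEfin.subset hXE
    have hdep : M.Dep X := by
      rw [← Matroid.eRk_lt_encard_iff_dep_of_finite hXfin hXE, ← hXfin.cast_ncard_eq, hX3]
      exact lt_of_le_of_lt hXr (by norm_num)
    exact ⟨hXE, isCircuit_of_dep_three_of_no_dep_pair M hXE hX3 hdep
      (fun P hP hP2 => hno P (hP.trans hXE) hP2), hX3⟩
  have hc := ncard_isCircuit_ncard_eq_le M (ν := ν) (k := 3) (by norm_num) (subset_refl M.E)
    (ncard_ground_eq_eRk_toNat_add M hd).le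
  rw [show ν + 3 - 1 = ν + 2 by omega] at hc
  exact (Set.ncard_le_ncard hsub (hEfin.finite_subsets.subset (fun X hX => hX.1))).trans hc

/-- **`4 · Q₄² ≤ (ν − 2) · C(ν + 2, 3)` without dependent pairs** (`2 < rk E`). -/
theorem four_mul_ncard_four_eRk_le_two_le_of_no_dep_pair (M : Matroid α) [M.Finite] (hK : ∀ e, ¬ M.IsColoop e)
    {ν : ℕ} (hd : M.E.encard = M.eRank + (ν : ℕ∞))
    (h0 : {P : Set α | P ⊆ M.E ∧ P.ncard = 2 ∧ M.Dep P}.ncard = 0) (hs : 2 < (M.eRk M.E).toNat) :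
    4 * {X : Set α | X ⊆ M.E ∧ X.ncard = 4 ∧ M.eRk X ≤ 2}.ncard ≤ (ν - 2) * (ν + 2).choose 3 := by
  have hEfin := M.ground_finite
  have hdc := mul_ncard_le_of_eRk M hK hd (k := 4) (s := 2) (by norm_num) (by norm_num) hs
  have h31 : {Y : Set α | Y ⊆ M.E ∧ Y.ncard = 4 - 1 ∧ M.eRk Y ≤ ((2 - 1 : ℕ) : ℕ∞)}.ncard = 0 := by
    have := ncard_three_eRk_le_one_eq_zero_of_no_dep_pair M h0
    simpa using this
  have hex : {Y : Set α | Y ⊆ M.E ∧ Y.ncard = 4 - 1 ∧ M.eRk Y = 2}.ncard ≤ (ν + 2).choose 3 := by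
    refine (Set.ncard_le_ncard ?_ (hEfin.finite_subsets.subset (fun X hX => hX.1))).trans
      (ncard_three_eRk_le_two_le_of_no_dep_pair M hd h0)
    intro Y hY
    exact ⟨hY.1, by simpa using hY.2.1, le_of_eq hY.2.2⟩
  rw [h31, mul_zero, add_zero] at hdc
  rw [show 2 + ν - 4 = ν - 2 by omega] at hdc
  exact hdc.trans (Nat.mul_le_mul_left _ hex)

/-- **`D₄ ≤ (n − 3) · C(ν + 2, 3) + C(ν + 3, 4)` without dependent pairs** (rank form). -/
theorem ncard_four_eRk_le_three_le_of_no_dep_pair (M : Matroid α) [M.Finite] {ν : ℕ}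
    (hd : M.E.encard = M.eRank + (ν : ℕ∞))
    (h0 : {P : Set α | P ⊆ M.E ∧ P.ncard = 2 ∧ M.Dep P}.ncard = 0) :
    {X : Set α | X ⊆ M.E ∧ X.ncard = 4 ∧ M.eRk X ≤ 3}.ncard ≤
      (M.E.ncard - 3) * (ν + 2).choose 3 + (ν + 3).choose 4 := by
  have hEfin := M.ground_finite
  have hs := ncard_dep_four_le_split_general M
  rw [h0, mul_zero, zero_add] at hs
  have hc3 := ncard_isCircuit_ncard_eq_le M (ν := ν) (k := 3) (by norm_num) (subset_refl M.E)
    (ncard_ground_eq_eRk_toNat_add M hd).le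
  have hc4 := ncard_isCircuit_ncard_eq_le M (ν := ν) (k := 4) (by norm_num) (subset_refl M.E)
    (ncard_ground_eq_eRk_toNat_add M hd).le
  rw [show ν + 3 - 1 = ν + 2 by omega] at hc3
  rw [show ν + 4 - 1 = ν + 3 by omega] at hc4
  have hc3' : (M.E.ncard - 3) * {C : Set α | C ⊆ M.E ∧ M.IsCircuit C ∧ C.ncard = 3}.ncard ≤
      (M.E.ncard - 3) * (ν + 2).choose 3 := Nat.mul_le_mul_left _ hc3
  have hsub := Set.ncard_le_ncard (four_eRk_le_three_subset_dep M)
    (hEfin.finite_subsets.subset (fun X hX => hX.1))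
  omega

/-- **`5 · Q₅² ≤ (ν − 3) · Q₄²` without dependent pairs** (`2 < rk E`). -/
theorem five_mul_ncard_five_eRk_le_two_le_of_no_dep_pair (M : Matroid α) [M.Finite] (hK : ∀ e, ¬ M.IsColoop e)
    {ν : ℕ} (hd : M.E.encard = M.eRank + (ν : ℕ∞))
    (h0 : {P : Set α | P ⊆ M.E ∧ P.ncard = 2 ∧ M.Dep P}.ncard = 0) (hs : 2 < (M.eRk M.E).toNat) :
    5 * {X : Set α | X ⊆ M.E ∧ X.ncard = 5 ∧ M.eRk X ≤ 2}.ncard ≤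
      (ν - 3) * {X : Set α | X ⊆ M.E ∧ X.ncard = 4 ∧ M.eRk X ≤ 2}.ncard := by
  have hEfin := M.ground_finite
  have hdc := mul_ncard_le_of_eRk M hK hd (k := 5) (s := 2) (by norm_num) (by norm_num) hs
  have h41 : {Y : Set α | Y ⊆ M.E ∧ Y.ncard = 5 - 1 ∧ M.eRk Y ≤ ((2 - 1 : ℕ) : ℕ∞)}.ncard = 0 := by
    have := ncard_four_eRk_le_one_eq_zero_of_no_dep_pair M h0
    simpa using this
  have hex : {Y : Set α | Y ⊆ M.E ∧ Y.ncard = 5 - 1 ∧ M.eRk Y = 2}.ncard ≤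
      {X : Set α | X ⊆ M.E ∧ X.ncard = 4 ∧ M.eRk X ≤ 2}.ncard := by
    refine Set.ncard_le_ncard ?_ (hEfin.finite_subsets.subset (fun X hX => hX.1))
    intro Y hY
    exact ⟨hY.1, by simpa using hY.2.1, le_of_eq hY.2.2⟩
  rw [h41, mul_zero, add_zero] at hdc
  rw [show 2 + ν - 5 = ν - 3 by omega] at hdc
  exact hdc.trans (Nat.mul_le_mul_left _ hex)

/-- **`5 · Q₅³ ≤ (ν − 2) · Q₄³ + (n − 4) · Q₄²`** (coloop-free, nullity `ν`, `3 < rk E`; no simplicity needed). -/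
theorem five_mul_ncard_five_eRk_le_three_le (M : Matroid α) [M.Finite] (hK : ∀ e, ¬ M.IsColoop e)
    {ν : ℕ} (hd : M.E.encard = M.eRank + (ν : ℕ∞)) (hs : 3 < (M.eRk M.E).toNat) :
    5 * {X : Set α | X ⊆ M.E ∧ X.ncard = 5 ∧ M.eRk X ≤ 3}.ncard ≤
      (ν - 2) * {X : Set α | X ⊆ M.E ∧ X.ncard = 4 ∧ M.eRk X ≤ 3}.ncard +
        (M.E.ncard - 4) * {X : Set α | X ⊆ M.E ∧ X.ncard = 4 ∧ M.eRk X ≤ 2}.ncard := by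
  have hEfin := M.ground_finite
  have hdc := mul_ncard_le_of_eRk M hK hd (k := 5) (s := 3) (by norm_num) (by norm_num) hs
  have hex : {Y : Set α | Y ⊆ M.E ∧ Y.ncard = 5 - 1 ∧ M.eRk Y = 3}.ncard ≤
      {X : Set α | X ⊆ M.E ∧ X.ncard = 4 ∧ M.eRk X ≤ 3}.ncard := by
    refine Set.ncard_le_ncard ?_ (hEfin.finite_subsets.subset (fun X hX => hX.1))
    intro Y hY
    exact ⟨hY.1, by simpa using hY.2.1, le_of_eq hY.2.2⟩
  have hlow : {Y : Set α | Y ⊆ M.E ∧ Y.ncard = 5 - 1 ∧ M.eRk Y ≤ ((3 - 1 : ℕ) : ℕ∞)}.ncard =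
      {X : Set α | X ⊆ M.E ∧ X.ncard = 4 ∧ M.eRk X ≤ 2}.ncard := by
    congr 1
  rw [hlow, show 3 + ν - 5 = ν - 2 by omega] at hdc
  rw [show (5 : ℕ) - 1 = 4 by norm_num] at hdc hex
  exact hdc.trans (Nat.add_le_add_right (Nat.mul_le_mul_left _ hex) _)

end S1CFG

end PercRepro
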